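import Literature.NumberTheory.EllipticCurves.IwasawaNakayamaProofs
import HarnessLib

/-!
# Route `ByReductionTypeAtTwo` (rung K4), crux `SupersingularRankZeroAtTwo` (item stmt-BirchSwinnertonDyer-19097):
# the two field identities of the TWISTED dual pair `T + p ↔ ψ + p` (brick [C] of K67-EC, content part)
# (seat `bsd-2adic-ss-1`, GEN 17; companion of `ByReductionTypeAtTwoSupersingularIwasawaTranslation`)

HONEST FRAMING (cell `bsd-2adic`, run/shared/lean/pub/bsd-2adic/): THEOREMS ONLY — additive
bookkeeping for an axiomatic Pontryagin dual pair (`IwasawaDual.IsDualPair p ψ toDual`: a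
`Λ = ℤ_p⟦T⟧`-module `X ≅ Hom(S, ℚ/ℤ)` with `T ↔ ψ`); no definition, no named fact, no `sorry`, no
instance; nothing about any curve; nothing booked; BSD is not proved by any of this.
PARTITION (D-0054): X5@2 good-ss r₀ block × p = 2 — types-the-object-of (the dual pair at the order-2
character); closes none. bears_on: K4 (route-BirchSwinnertonDyer-ByReductionTypeAtTwo item 19097).

## What and why

K67-EC (`OddBlindPackage.FlatBlindEulerCharAtTwo`, stub 4 of the alternative line
`Cruxes/SupersingularRankZeroAtTwo/Lines/odd_blind_package.lean`) is Greenberg's Lemma 4.2 — in the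
tree for ANY dual pair, `IwasawaDual.IsDualPair.constantCoeff_charGenerator_mul_natCard_endCoinvariants`
— applied to the pair (`X♭` with scalars restricted along the translation `τ_2 : T ↦ T + 2` of
`ByReductionTypeAtTwoSupersingularIwasawaTranslation`, `Sel♭` with `ψ' = conj_γ + 1 = ψ + 2`).  Of the
four fields of `IsDualPair` for the twisted pair, `bijective` and `C_smul` are verbatim; this file
proves the CONTENT of the other two, on the ORIGINAL module (no type synonym needed here):

* `toDual_X_add_C_natCast_smul` — **`toDual ((T + n)·x) s = toDual x ((ψ + n) s)`** for every
  `n : ℕ` (the `T_smul` field of the twisted pair, `n = p = 2`): from `T_smul`, `C_smul` and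
  `(n mod p^k)·t = n·t` on `p^k`-torsion values;
* `isLocNil_add_natCast_of_dvd` — **`(p, ψ)` locally nilpotent ⇒ `(p, ψ + n)` locally nilpotent when
  `p ∣ n`** (the `locNil` field; at `p = 2`, `n = 2`: `(ψ + 2)^{N+k} s = 0` when `ψ^N s = 0 = 2^k s`,
  by the binomial theorem for the commuting pair `(ψ, n)` in `End S`) — this is exactly where
  `p = 2` enters: the order-2 character `γ ↦ -1` is congruent to the trivial one mod `2`.

Remaining for K67-EC (not here): [B] `Module.charIdeal` of the scalar restriction along `τ_2`
(`= τ_{-2}(char X)`, generator read at `0` as `f(-2)` by `IwasawaTranslation.constantCoeff_translate`);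
[C'] the type-synonym packaging of the twisted pair as an `IsDualPair p (ψ + 2) toDual`; [D] the
application of Lemma 4.2.

References: R. Greenberg, LNM 1716 (1999), §1 p. 60 and §4 Lemma 4.2 [cite: GreenbergLNM1716, §4 Lemma 4.2];
B. Mazur, J. Tate, J. Teitelbaum, Invent. Math. 84 (1986), §I.14 [cite: MazurTateTeitelbaum1986Invent, §I.14].
-/

set_option autoImplicit false
-- the Theorems namespace of this sub repeats the summit name by design (D-0017 nested layout)
set_option linter.dupNamespace false

noncomputable section

namespace Summit.BirchSwinnertonDyer.BirchSwinnertonDyer.Theorems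

namespace IwasawaTranslation

open Literature.NumberTheory.EllipticCurves Literature.NumberTheory.EllipticCurves.IwasawaDual

variable {p : ℕ} [Fact p.Prime]
variable {S : Type*} [AddCommGroup S] {ψ : AddMonoid.End S}
variable {X : Type*} [AddCommGroup X] [Module (PowerSeries ℤ_[p]) X]
variable {toDual : X →+ (S →+ AddCircle (1 : ℚ))}

/-! ### Torsion bookkeeping on values of characters -/

omit [Fact p.Prime] in
/-- If `p^k · s = 0` then `p^k · χ(s) = 0` for every character `χ : S → ℚ/ℤ`. [folklore] -/
theorem pow_smul_apply_eq_zero (χ : S →+ AddCircle (1 : ℚ)) {k : ℕ} {s : S} (hs : p ^ k • s = 0) :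
    p ^ k • χ s = 0 := by
  rw [← map_nsmul, hs, map_zero]

omit [Fact p.Prime] in
/-- On a `p^k`-torsion element, `(n mod p^k) · t = n · t`. [folklore] -/
theorem mod_pow_smul_eq {A : Type*} [AddCommGroup A] {k n : ℕ} {t : A} (ht : p ^ k • t = 0) :
    (n % p ^ k) • t = n • t := by
  calc (n % p ^ k) • t = (n % p ^ k) • t + (n / p ^ k) • (p ^ k • t) := by rw [ht, smul_zero, add_zero]
    _ = (n % p ^ k + p ^ k * (n / p ^ k)) • t := by rw [add_smul, mul_comm, mul_smul]
    _ = n • t := by rw [Nat.mod_add_div]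

/-- The value of `PadicInt.toZModPow k` on a natural number is its residue:
`(toZModPow k n).val = n % p^k`. [folklore] -/
theorem val_toZModPow_natCast (k n : ℕ) : (PadicInt.toZModPow k (n : ℤ_[p])).val = n % p ^ k := by
  rw [map_natCast, ZMod.val_natCast]

/-! ### The `T_smul` field of the twisted pair -/

/-- **`toDual ((T + n)·x) s = toDual x ((ψ + n) s)`** for a dual pair `T ↔ ψ` and every `n : ℕ`:
`T ↔ ψ` by `T_smul`, and the constant `n` acts on the `p^k`-torsion value `toDual x s` through
`n mod p^k`, i.e. as `n` (`C_smul`).  With `n = p = 2` this is the `T_smul` field of the dual pair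
TWISTED by the translation `T ↦ T + 2` (the order-2 character `γ ↦ -1`: `γ + 1 = (γ - 1) + 2`).
[folklore] -/
theorem toDual_X_add_C_natCast_smul (h : IsDualPair p ψ toDual) (n : ℕ) (x : X) (s : S) :
    toDual ((PowerSeries.X + PowerSeries.C ((n : ℕ) : ℤ_[p])) • x) s =
      toDual x ((ψ + (n : AddMonoid.End S)) s) := by
  obtain ⟨k, hk⟩ := h.locNil.torsion s
  rw [add_smul, map_add, AddMonoidHom.add_apply, h.T_smul, h.C_smul _ x s k hk, val_toZModPow_natCast,
    mod_pow_smul_eq (pow_smul_apply_eq_zero (toDual x) hk)]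
  change _ = toDual x (ψ s + (n : AddMonoid.End S) s)
  rw [AddMonoid.End.natCast_apply, map_add, map_nsmul]

/-! ### The `locNil` field of the twisted pair -/

omit [Fact p.Prime] in
/-- Powers of `ψ` beyond a killing exponent still kill: `ψ^N s = 0`, `N ≤ i` ⇒ `ψ^i s = 0`. [folklore] -/
theorem pow_apply_eq_zero_of_le {N i : ℕ} {s : S} (hN : (ψ ^ N) s = 0) (hi : N ≤ i) : (ψ ^ i) s = 0 := by
  obtain ⟨j, rfl⟩ := Nat.exists_eq_add_of_le hi
  rw [add_comm, pow_add, AddMonoid.End.coe_mul, Function.comp_apply, hN, map_zero]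

omit [Fact p.Prime] in
/-- `ψ^i` preserves `p^k`-torsion. [folklore] -/
theorem pow_smul_pow_apply_eq_zero {k i : ℕ} {s : S} (hk : p ^ k • s = 0) : p ^ k • (ψ ^ i) s = 0 := by
  rw [← map_nsmul, hk, map_zero]

omit [Fact p.Prime] in
/-- A natural-number multiple divisible by `p^k` kills `p^k`-torsion. [folklore] -/
theorem smul_eq_zero_of_pow_dvd {A : Type*} [AddCommGroup A] {k m : ℕ} {t : A} (ht : p ^ k • t = 0)
    (hm : p ^ k ∣ m) : m • t = 0 := by
  obtain ⟨q, rfl⟩ := hm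
  rw [mul_comm, mul_smul, ht, smul_zero]

omit [Fact p.Prime] in
/-- Evaluation at `s` commutes with finite sums of endomorphisms. [folklore] -/
theorem finsetSum_end_apply {ι : Type*} (t : Finset ι) (f : ι → AddMonoid.End S) (s : S) :
    (∑ i ∈ t, f i) s = ∑ i ∈ t, f i s := by
  classical
  induction t using Finset.induction_on with
  | empty => rw [Finset.sum_empty, Finset.sum_empty]; rfl
  | insert a t ha ih =>
    rw [Finset.sum_insert ha, Finset.sum_insert ha, ← ih]
    rfl

omit [Fact p.Prime] in
/-- **`(p, ψ)` locally nilpotent ⇒ `(p, ψ + n)` locally nilpotent for `p ∣ n`.**  If `ψ^N s = 0` and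
`p^k s = 0` then `(ψ + n)^{N+k} s = 0`: expand by the binomial theorem (`ψ` and `n` commute in
`End S`); a term `C(N+k, i)·n^{N+k-i}·ψ^i s` vanishes for `i ≥ N` by `ψ^N s = 0` and for `i < N`
because then `p^k ∣ n^{N+k-i}`.  At `p = 2`, `n = 2` this is the `locNil` field of the dual pair
twisted by the order-2 character — the point where `p = 2` is used (`γ + 1 ≡ γ - 1 (mod 2)`). [folklore] -/
theorem isLocNil_add_natCast_of_dvd (h : IsLocNil p ψ) {n : ℕ} (hn : p ∣ n) :
    IsLocNil p (ψ + (n : AddMonoid.End S)) where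
  torsion := h.torsion
  nil s := by
    obtain ⟨k, hk⟩ := h.torsion s
    obtain ⟨N, hN⟩ := h.nil s
    refine ⟨N + k, ?_⟩
    have hcomm : Commute ψ (n : AddMonoid.End S) := (Nat.cast_commute n ψ).symm
    rw [hcomm.add_pow, finsetSum_end_apply]
    refine Finset.sum_eq_zero fun i _ => ?_
    -- the `i`-th term: `(ψ^i * n^(N+k-i) * C) s = (n^(N+k-i) * C) • ψ^i s`
    have hterm : (ψ ^ i * (n : AddMonoid.End S) ^ (N + k - i) * ((N + k).choose i : AddMonoid.End S)) s =
        (n ^ (N + k - i) * (N + k).choose i) • (ψ ^ i) s := by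
      rw [← Nat.cast_pow, mul_assoc, ← Nat.cast_mul, AddMonoid.End.coe_mul, Function.comp_apply,
        AddMonoid.End.natCast_apply, map_nsmul]
    rw [hterm]
    by_cases hiN : N ≤ i
    · rw [pow_apply_eq_zero_of_le hN hiN, smul_zero]
    · refine smul_eq_zero_of_pow_dvd (pow_smul_pow_apply_eq_zero hk) (Dvd.dvd.mul_right ?_ _)
      -- `p^k ∣ n^(N+k-i)`: `p^k ∣ p^(N+k-i)` (as `k ≤ N + k - i`) and `p^(N+k-i) ∣ n^(N+k-i)`
      exact (pow_dvd_pow p (by omega)).trans (pow_dvd_pow_of_dvd hn _)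

end IwasawaTranslation

end Summit.BirchSwinnertonDyer.BirchSwinnertonDyer.Theorems

end
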